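import Literature.Geometry.Lorentzian.RicciDecay
import Literature.Geometry.Lorentzian.MetricNormSqBounds
import Literature.Geometry.Lorentzian.RicciSection
import Literature.Geometry.Lorentzian.RicciVariationStepsProofs
import HarnessLib

/-!
# The Ricci variation of Schoen–Yau, IV: the family `ds² + t Ric` exists

Step `ha` of the Ricci variation (Schoen–Yau, Comm. Math. Phys. 65 (1979), §3, p. 72: *"We
define a one-parameter family of metrics `ds²_t` on `N` by `ds²_t = ds² + t Ric` … These metrics
are defined in a neighborhood of `t = 0`"*) has two halves: the family exists as Riemannian data
near `t = 0`, and it is asymptotically flat for small `t` ("by (1.2)", p. 73). This file proves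
the first half on a one-ended manifold with `h − δ = o₅(r⁻²)` on the end (all results proved, no
named facts):

* `AFEnd.exists_isCompact_union_far` — a one-ended manifold is a compact set plus a far region;
* `AFEnd.exists_bound_normSq_ricci_univ`, `exists_bound_abs_ricci_le` — **`Ric` is uniformly
  bounded by the metric**, `|Ric(v,v)| ≤ C h(v,v)` (continuity of `‖Ric‖²_h` on the compact core,
  the decay `‖Ric‖² ≤ K r⁻⁸` on the far region, `RicciDecay.lean`, and Cauchy–Schwarz for the
  metric square norm, `MetricNormSqBounds.lean`);
* `AFEnd.exists_ricciFamily` — **the family `D_t = (h + t Ric, k)` for `|t| < 1/(C+1)`**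
  (`InitialDataSet.addRicci`, `RicciSection.lean`).

The family is consumed by the reduction of step 2 of positive mass rigidity to the elliptic steps
of the printed proof (`exists_ricciVariation_negativeMass_of_massZero_of_elliptic_steps`,
`RicciVariationEllipticSteps.lean`).

## References

* R. Schoen, S.-T. Yau, *On the proof of the positive mass conjecture in general relativity*,
  Comm. Math. Phys. 65 (1979) 45–76, §3, pp. 63, 72–74.
-/

noncomputable section

open Bundle Set Function Filter TopologicalSpace Manifold Metric
open scoped Manifold ContDiff Topology

namespace Literature.Geometry.Lorentzian

namespace AFEnd

variable {X : Type} [TopologicalSpace X] [ChartedSpace E3 X] [IsManifold (𝓡 3) ∞ X]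
  (e : AFEnd X) (D : InitialDataSet (𝓡 3) X)

omit [IsManifold (𝓡 3) ∞ X] in
/-- **A one-ended manifold is a compact set plus a far region**: if `e` is the only end
(`IsSoleEnd`), then for every `R₂ > R` there is a compact `K ⊆ X` with `X = K ∪ {R₂ < r}` — the
compact complement of a far region `{R' < r}` together with the image of the compact annulus
`{R' ≤ ‖z‖ ≤ R₂}` under the inverse chart. Schoen–Yau 1979, p. 63 ("we may assume that `N` has
only one end, so that `N ∖ N_k` is compact"). [cite: SchoenYauPMT1979, §3 p. 63] -/
theorem exists_isCompact_union_far (hsole : e.IsSoleEnd) {R₂ : ℝ} (hR₂ : e.R < R₂) :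
    ∃ K : Set X, IsCompact K ∧ (univ : Set X) ⊆ K ∪ e.far R₂ := by
  obtain ⟨R', hRR', hcpt⟩ := hsole
  set A : Set E3 := {z | min R' R₂ ≤ ‖z‖ ∧ ‖z‖ ≤ R₂} with hA
  have hAext : A ⊆ {z | e.R < ‖z‖} := fun z hz ↦ (lt_min hRR' hR₂).trans_le hz.1
  have hAc : IsCompact A := by
    have : A = closedBall (0 : E3) R₂ ∩ {z | min R' R₂ ≤ ‖z‖} := by
      ext z
      simp only [hA, mem_setOf_eq, mem_inter_iff, mem_closedBall_zero_iff]
      tauto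
    rw [this]
    exact (isCompact_closedBall _ _).inter_right (isClosed_le continuous_const continuous_norm)
  have hcont : ContinuousOn e.dataChartExt {z | e.R < ‖z‖} := fun z hz ↦
    (e.contMDiffAt_dataChartExt hz).continuousAt.continuousWithinAt
  refine ⟨(e.far R')ᶜ ∪ e.dataChartExt '' A,
    hcpt.union (hAc.image_of_continuousOn (hcont.mono hAext)), fun p _ ↦ ?_⟩
  by_cases hp : p ∈ e.far R₂
  · exact Or.inr hp
  by_cases hp' : p ∈ e.far R'
  · obtain ⟨z, hz, rfl⟩ := e.mem_far_iff.1 hp'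
    refine Or.inl (Or.inr ⟨z, ⟨(min_le_left _ _).trans hz.le, ?_⟩, e.dataChartExt_of_lt z.2⟩)
    by_contra hlt
    push Not at hlt
    exact hp (e.mem_far_iff.2 ⟨z, hlt, rfl⟩)
  · exact Or.inl (Or.inl hp')

/-- **`‖Ric‖²_h` is bounded on a one-ended asymptotically flat manifold**: under
`h − δ = o₅(r⁻²)` on the only end, `sup_X ‖Ric‖²_h < ∞` (continuity on the compact core,
`exists_isCompact_union_far`, and the decay `‖Ric‖²(Φ z) ≤ K ‖z‖⁻⁸ ≤ |K|` on the far region,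
`exists_bound_normSq_ricci`). Schoen–Yau 1979, p. 72–73 (the family `ds² + t Ric` is a metric
for small `t`). [cite: SchoenYauPMT1979, §3 pp. 72–73] -/
theorem exists_bound_normSq_ricci_univ [D.metric.HasLeviCivita]
    (haf : e.IsStronglyAsymptoticallyFlatWith D 0 2 0 5 0) (hsole : e.IsSoleEnd) :
    ∃ S : ℝ, ∀ x : X, D.metric.normSq x (D.metric.ricci x) ≤ S := by
  set f : X → ℝ := fun x ↦ D.metric.normSq x (D.metric.ricci x) with hf
  have hfc : Continuous f := (D.metric.contMDiff_normSq_ricci').continuous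
  have hAF : e.IsMetricAsymptoticallyFlat D 2 :=
    AFEnd.IsStronglyAsymptoticallyFlatWith.isMetricAsymptoticallyFlat_of_massZero e D haf
      (by norm_num)
  obtain ⟨K, R₁, hRR₁, h1R₁, hbound⟩ := e.exists_bound_normSq_ricci D two_pos hAF
  obtain ⟨Kc, hKc, hcover⟩ := e.exists_isCompact_union_far hsole hRR₁
  obtain ⟨S₀, hS₀⟩ := hKc.bddAbove_image hfc.continuousOn
  refine ⟨max S₀ |K|, fun x ↦ ?_⟩
  rcases hcover (mem_univ x) with hx | hx
  · exact (hS₀ (mem_image_of_mem f hx)).trans (le_max_left _ _)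
  · obtain ⟨z, hz, rfl⟩ := e.mem_far_iff.1 hx
    have hz1 : 1 ≤ ‖(z : E3)‖ := h1R₁.trans hz.le
    have h := hbound z hz.le
    rw [e.dataChartExt_of_lt z.2] at h
    refine h.trans ((le_abs_self _).trans ?_) |>.trans (le_max_right _ _)
    rw [abs_mul]
    refine mul_le_of_le_one_right (abs_nonneg _) ?_
    rw [abs_of_nonneg (Real.rpow_nonneg (norm_nonneg _) _)]
    exact Real.rpow_le_one_of_one_le_of_nonpos hz1 (by norm_num)

/-- **The Ricci tensor is uniformly bounded by the metric**: on a one-ended manifold with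
`h − δ = o₅(r⁻²)` on the end there is `C ≥ 0` with `|Ric(v, v)| ≤ C h(v, v)` for all tangent
vectors (`|Ric(v,v)| ≤ √‖Ric‖²_h · h(v,v)`, `abs_apply_le_sqrt_normSq_mul`, and
`exists_bound_normSq_ricci_univ`); hence `ds² + t Ric` is positive definite for `|t| C < 1`
(Schoen–Yau 1979, p. 72: "These metrics are defined in a neighborhood of `t = 0`").
[cite: SchoenYauPMT1979, §3 p. 72] -/
theorem exists_bound_abs_ricci_le [D.metric.HasLeviCivita]
    (haf : e.IsStronglyAsymptoticallyFlatWith D 0 2 0 5 0) (hsole : e.IsSoleEnd) :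
    ∃ C : ℝ, 0 ≤ C ∧ ∀ (x : X) (v : TangentSpace (𝓡 3) x),
      |D.metric.ricci x v v| ≤ C * D.metric.val x v v := by
  obtain ⟨S, hS⟩ := e.exists_bound_normSq_ricci_univ D haf hsole
  refine ⟨Real.sqrt S, Real.sqrt_nonneg _, fun x v ↦ ?_⟩
  have h0 : 0 ≤ D.metric.val x v v := by
    by_cases hv : v = 0
    · simp [hv]
    · exact (D.isRiemannian_metric x v hv).le
  calc |D.metric.ricci x v v|
      ≤ Real.sqrt (D.metric.normSq x (D.metric.ricci x)) * D.metric.val x v v :=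
        D.metric.abs_apply_le_sqrt_normSq_mul x D.isRiemannian_metric _ v
    _ ≤ Real.sqrt S * D.metric.val x v v := by
        gcongr
        exact hS x

/-! ### The family `ds²_t = ds² + t Ric` -/

/-- **The Ricci variation exists near `t = 0`** (Schoen–Yau, Comm. Math. Phys. 65 (1979), p. 72:
"We define a one-parameter family of metrics `ds²_t` on `N` by `ds²_t = ds² + t Ric` … These
metrics are defined in a neighborhood of `t = 0` by (1.1) and (1.2), and `ds²₀ = ds²`"): on a
one-ended manifold with `h − δ = o₅(r⁻²)` on the end there are `τ > 0` and data `D_t`,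
`|t| < τ`, with metric `h + t Ric(h)` pointwise and the same `k` (`InitialDataSet.addRicci` with
the global bound `exists_bound_abs_ricci_le`, `τ = 1/(C+1)`; `D_t = D` for `|t| C ≥ 1`).
[cite: SchoenYauPMT1979, §3 p. 72] -/
theorem exists_ricciFamily [D.metric.HasLeviCivita]
    (haf : e.IsStronglyAsymptoticallyFlatWith D 0 2 0 5 0) (hsole : e.IsSoleEnd) :
    ∃ (τ : ℝ) (Dt : ℝ → InitialDataSet (𝓡 3) X), 0 < τ ∧ ∀ t : ℝ, |t| < τ →
      (∀ (x : X) (v w : TangentSpace (𝓡 3) x),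
        (Dt t).metric.val x v w = D.metric.val x v w + t * D.metric.ricci x v w) ∧
      (∀ x : X, (Dt t).k x = D.k x) := by
  classical
  obtain ⟨C, hC0, hC⟩ := e.exists_bound_abs_ricci_le D haf hsole
  refine ⟨1 / (C + 1), fun t ↦ if ht : |t| * C < 1 then D.addRicci hC t ht else D,
    by positivity, fun t ht ↦ ?_⟩
  have ht' : |t| * C < 1 := by
    have h1 : |t| * (C + 1) < 1 := by rwa [lt_div_iff₀ (by positivity)] at ht
    nlinarith [abs_nonneg t]
  simp only [dif_pos ht']
  exact ⟨fun x v w ↦ D.metric_addRicci_val hC t ht' x v w, fun x ↦ D.addRicci_k hC t ht' x⟩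

end AFEnd

end Literature.Geometry.Lorentzian

end
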